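import Literature.Computability.QuantumComplexity.Sampling
import HarnessLib
import HarnessLib.Audit

/-!
# Post-selected IQP and the Bremner–Jozsa–Shepherd collapse argument

Family `quantum-advantage`; companion to `Sampling.lean` (statement **quantum-advantage.S22**).
Source: M. J. Bremner, R. Jozsa, D. J. Shepherd, *Classical simulation of commuting quantum
computations implies collapse of the polynomial hierarchy*, Proc. R. Soc. A 467 (2011) 459–472
(arXiv:1005.1407; cited below as BJS with the arXiv pagination), together with the classical
ingredients its Corollary 1 imports: Toda's theorem (`PH ⊆ P^PP`), Han–Hemaspaandra–Thierauf
(`BPP_path ⊆ P^{Σ₂ᵖ}`), Stockmeyer (`Δₖ₊₁ᵖ ⊆ Σₖ₊₁ᵖ ∩ Πₖ₊₁ᵖ`).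

This file

* records why S22 as vendored (`PH_eq_DeltaP_three_of_iqp_multiplicative`) is **mis-stated**
  (its simulators may be non-uniform, see below) and vendors the corrected statement
  `PH_eq_DeltaP_three_of_uniform_iqp_multiplicative` (BJS Cor. 1) next to BJS Thm. 2
  (`PostBPP_eq_PP_of_uniform_iqp_multiplicative`);
* defines post-selected IQP families and the classes `PostIQPWith ε` / `PostIQP` (BJS Def. 3) in
  the tree's circuit-family model;
* vendors the ingredients of BJS's proof as named facts — `PP_subset_PostIQPWith` (BJS Thm. 1),
  `mem_PostBPP_of_samplesMultiplicative` (the argument of BJS Thm. 2),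
  `toda_PH_subset_PRelClass_PP` (Toda 1991), `PostBPP_subset_DeltaP_three` (HHT 1997,
  Thm. 3.11(1)), `DeltaP_succ_subset_SigmaP_inter_PiP` (Stockmeyer 1976, §3);
* and **proves** the two assembly steps exactly as printed: Thm. 2 from Thm. 1 + the simulation
  argument + `PostBPP ⊆ PP` (`PostBPP_eq_PP_of_uniform_iqp_multiplicative_of_facts`), and Cor. 1
  from Thm. 2 + Toda + HHT + `P^{P^{Σ₂}} = P^{Σ₂}` + `Δ₃ ⊆ Σ₃`
  (`PH_eq_DeltaP_three_of_uniform_iqp_multiplicative_of_facts`).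

## Why S22 is mis-stated (uniformity of the simulator)

S22's hypothesis asks, for every uniform IQP family, for a sampler `A : RandAlg` with
`IsPPT A id ∧ A.SamplesMultiplicative F.kernel c`. `IsPPT` (= `RandAlg.IsPolyTime`) only bounds
the coin budget `A.coinLen ≤ poly`; `RandAlg.outputPMF` feeds *exactly* `coinLen |x|` coins and
`A.run` may read `|r|`, so such a sampler receives the (possibly non-computable) number
`coinLen |x| ≤ p |x|` — `O(log |x|)` bits of advice. The tree already flags this for `BPP`
(`Literature.Computability.Complexity.mem_BPP_iff_randAlg`, `Literature.Computability.QuantumComplexity.mem_BPP_iff_gill`: uniform machines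
carry the extra conjunct `∃ q : Polynomial ℕ, ∀ n, A.coinLen n = q.eval n`). BJS's simulators
are uniform ("sampled by purely classical means in poly(n) time", §2.5(c), by "uniform families
of classical randomised circuits", Def. 1 and §2.2), and their proof turns the simulator into a
*uniform* post-BPP machine; with advice it only yields `PP ⊆ PostBPP/log`, from which
`PH = Δ₃ᵖ` does not follow by any argument in print. The corrected statements below add the
exact-polynomial coin budget. They also fix the quantifier order to the one BJS's proof uses
(`∃ c < √2, ∀ families`: the proof of Thm. 2 fixes `c` and then chooses the error level `δ` with
`c² < 1 + 2δ`, which changes the family), where S22 had `∀ family, ∃ c`.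

## The tree's IQP model versus BJS's

BJS index circuits by the input word `w` (Def. 1: `w ↦ C_w` computable in `poly(|w|)` time,
`C_w` acting on `|0…0⟩`, Def. 2). The tree's `IQPFamily` (Q6 `SamplingProblems`) indexes the
diagonal part by the input *length* and runs `H^{⊗N} D_{|x|} H^{⊗N}` on `|x⟩|0…0⟩`
(`IQPFamily.kernel`); since `H^{⊗N}|x 0⟩ = Z^x H^{⊗N}|0⟩` and `H^{⊗N} Z^x = X^x H^{⊗N}`, this is
BJS's family `C_x = H^{⊗N} (Z^x D_{|x|}) H^{⊗N}` on `|0…0⟩` (with `Z ∈ iqpDiag`), so every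
tree-uniform family is BJS-uniform and the simulation hypothesis over tree families is *weaker*
than BJS's. The proof of Cor. 1 nevertheless goes through in the tree's model: BJS's Hadamard
gadget (proof of Thm. 1) applied to the length-indexed Clifford+T families of the tree's
`PostBQP` (input `|x⟩|0…0⟩`, Q4 `Postselection`) produces exactly a length-indexed diagonal part
run on `|x⟩|0…0⟩`, in which every physical input wire `i` is consumed by the gadget of the first
Hadamard on line `i` and is therefore *post-selected*. This is why `PostIQPFamily` below puts all
input wires into the post-selection register (normal form, see the docstring); the output wire and
the remaining post-selected wires are ancillas, brought to the positions `n` and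
`n+1, …, n+postLen n` by relabelling ancilla wires (which preserves IQP form and uniformity).

## Design choices

* Probabilities of post-selected IQP families are read off the classical kernel
  `IQPFamily.kernel x : PMF (List Bool)` (the object the simulation hypothesis is about), as real
  numbers via `toOuterMeasure … |>.toReal`, exactly like `QCircuitFamily.kernelProb`.
* Post-selection is on the all-`false` pattern (BJS: `0…0`; a `Z` before the final Hadamard
  flips a measured bit, so the pattern is immaterial); acceptance is "output wire reads `true`".
  Out-of-range positions read `false` (`List.getD`), a documented junk convention that only
  matters for families whose `postLen` exceeds the ancilla count.
* Error levels: `PostDecides F L ε` is BJS Def. 3 with tolerance `ε` written multiplicatively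
  (`(1-ε)·Pr[post] ≤ Pr[acc ∧ post]`, no division), as in the tree's `PostBPP`.
* The named facts keep the tree's fixed classes (`PP`, `PostBPP` with thresholds `2/3, 1/3`,
  `PRelClass`, `SigmaP`/`DeltaP` in quantifier form), so e.g. `mem_PostBPP_of_samplesMultiplicative`
  silently contains post-BPP error reduction (BJS §2.4 remark; HHT 1997 Thm. 3.1) and
  `DeltaP_succ_subset_SigmaP_inter_PiP` contains the quantifier characterisation
  (Stockmeyer 1976 Thm. 3.1). Each docstring says what its proof in print consists of.
* Nothing here is specific to `Problems/`; the general facts (Toda, HHT, Stockmeyer) are stated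
  where they are consumed and may be re-exported from `Complexity/` later.
-/

open Computability Literature.Computability.Complexity Literature.Computability.Cryptography

namespace Literature.Computability.QuantumComplexity

/-! ### Post-selected IQP families (BJS Def. 3 in the tree's circuit-family model) -/

/-- A **post-selected IQP family**: an IQP family (diagonal parts `diag n` on `n + ancillas n`
wires, run as `H^{⊗N} U_{diag n} H^{⊗N}` on `|x⟩|0…0⟩` and measured on all wires) together with
the size `postLen n` of its ancilla post-selection block. Register conventions (normal form, see
the module docstring): wires `0, …, n-1` (the input wires) and `n+1, …, n+postLen n` form the
post-selection register, wire `n` (the first ancilla) is the single-line output register, the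
remaining wires are ignored. (BJS 2011, Def. 3 with Def. 1 (iii)–(iv): "a specified single line
output register and a specified post-selection register".) [cite: BremnerJozsaShepherdPRSA2011, Def. 3] -/
structure PostIQPFamily extends IQPFamily where
  /-- The number of post-selected ancilla wires `n+1, …, n+postLen n` on inputs of length `n`. -/
  postLen : ℕ → ℕ

/-- The acceptance event on measured strings for input length `n`: the output wire `n` reads
`true`. (BJS 2011, Def. 3 (i): `Prob[O_w = 1 | …]`.) [cite: BremnerJozsaShepherdPRSA2011, Def. 3] -/
def iqpAcceptStrings (n : ℕ) : Set (List Bool) :=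
  {y | y.getD n false = true}

/-- The post-selection event on measured strings for input length `n` and block size `k`: the
input wires `0, …, n-1` and the block `n+1, …, n+k` all read `false` (BJS post-select on the
pattern `0…0`; out-of-range positions read `false` by the `List.getD` junk convention).
(BJS 2011, §2.4 and Def. 3: `Prob[P_w = 0…0]`.) [cite: BremnerJozsaShepherdPRSA2011, §2.4 and Def. 3] -/
def iqpPostselectStrings (n k : ℕ) : Set (List Bool) :=
  {y | (∀ i < n, y.getD i false = false) ∧ ∀ j < k, y.getD (n + 1 + j) false = false}

namespace PostIQPFamily

/-- **Uniformity** of a post-selected IQP family: the underlying IQP family is polynomial-time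
uniform (`IQPFamily.IsUniform`) and the register description `1^n ↦ 1^{postLen n}` is
polynomial-time computable — together, BJS's requirement that the whole description
`w ↦ C_w`, registers included, be computable in `poly(n)` time. (BJS 2011, Def. 1 and Def. 3.) [cite: BremnerJozsaShepherdPRSA2011, Def. 1 and Def. 3] -/
def IsUniform (F : PostIQPFamily) : Prop :=
  F.toIQPFamily.IsUniform ∧ PolyTimeComputable unaryEncodeNat unaryEncodeNat F.postLen

/-- `Pr[P = 0…0]`: the probability, under the output kernel of the family on input `x`, that the
post-selection register reads all-`false`. (BJS 2011, §2.4, eq. (1) (denominator).) [cite: BremnerJozsaShepherdPRSA2011, §2.4 eq. (1)] -/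
noncomputable def postselectProbOn (F : PostIQPFamily) (x : List Bool) : ℝ :=
  ((F.kernel x).toOuterMeasure (iqpPostselectStrings x.length (F.postLen x.length))).toReal

/-- `Pr[O = 1 ∧ P = 0…0]`: the probability, under the output kernel on input `x`, that the output
wire reads `true` and the post-selection register reads all-`false`.
(BJS 2011, §2.4, eq. (1) (numerator).) [cite: BremnerJozsaShepherdPRSA2011, §2.4 eq. (1)] -/
noncomputable def jointAcceptProbOn (F : PostIQPFamily) (x : List Bool) : ℝ :=
  ((F.kernel x).toOuterMeasure
    (iqpAcceptStrings x.length ∩ iqpPostselectStrings x.length (F.postLen x.length))).toReal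

/-- `F.PostDecides L ε`: the post-selected family decides `L` with error tolerance `ε` — on every
input the post-selection event has positive probability, and conditioned on it the output wire
reads `1` with probability `≥ 1 - ε` if `x ∈ L` and `≤ ε` if `x ∉ L` (written multiplicatively,
no division). (BJS 2011, Def. 3 (i)–(ii), with §2.4: `Prob[P = 0…0] ≠ 0`.) [cite: BremnerJozsaShepherdPRSA2011, Def. 3] -/
def PostDecides (F : PostIQPFamily) (L : Language Bool) (ε : ℝ) : Prop :=
  ∀ x : List Bool, 0 < F.postselectProbOn x ∧
    (x ∈ L → (1 - ε) * F.postselectProbOn x ≤ F.jointAcceptProbOn x) ∧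
    (x ∉ L → F.jointAcceptProbOn x ≤ ε * F.postselectProbOn x)

/-- Post-selection probabilities are nonnegative. [folklore] -/
theorem postselectProbOn_nonneg (F : PostIQPFamily) (x : List Bool) : 0 ≤ F.postselectProbOn x :=
  ENNReal.toReal_nonneg

/-- Joint acceptance probabilities are nonnegative. [folklore] -/
theorem jointAcceptProbOn_nonneg (F : PostIQPFamily) (x : List Bool) : 0 ≤ F.jointAcceptProbOn x :=
  ENNReal.toReal_nonneg

/-- `Pr[O = 1 ∧ P = 0…0] ≤ Pr[P = 0…0]` (event inclusion). (BJS 2011, §2.4, eq. (1).) [cite: BremnerJozsaShepherdPRSA2011, §2.4 eq. (1)] -/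
theorem jointAcceptProbOn_le_postselectProbOn (F : PostIQPFamily) (x : List Bool) :
    F.jointAcceptProbOn x ≤ F.postselectProbOn x := by
  unfold jointAcceptProbOn postselectProbOn
  refine ENNReal.toReal_mono ?_ ((F.kernel x).toOuterMeasure.mono Set.inter_subset_right)
  rw [PMF.toOuterMeasure_apply]
  exact (F.kernel x).tsum_coe_indicator_ne_top _

/-- Post-selection probabilities are at most `1`. [folklore] -/
theorem postselectProbOn_le_one (F : PostIQPFamily) (x : List Bool) : F.postselectProbOn x ≤ 1 :=
  ENNReal.toReal_le_of_le_ofReal zero_le_one <| by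
    rw [ENNReal.ofReal_one, ← ((F.kernel x).toOuterMeasure_apply_eq_one_iff Set.univ).2
      (Set.subset_univ _)]
    exact (F.kernel x).toOuterMeasure.mono (Set.subset_univ _)

end PostIQPFamily

/-- **`PostIQPWith ε`** (post-IQP at error tolerance `ε`): languages decided with error `ε` by a
uniform post-selected IQP family. (BJS 2011, Def. 3, for a fixed tolerance `0 < ε < 1/2`.) [cite: BremnerJozsaShepherdPRSA2011, Def. 3] -/
def PostIQPWith (ε : ℝ) : Set (Language Bool) :=
  {L | ∃ F : PostIQPFamily, F.IsUniform ∧ F.PostDecides L ε}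

/-- **post-IQP**: languages decided with *some* error tolerance `0 < ε < 1/2` by a uniform
post-selected IQP family. (BJS 2011, Def. 3.) [cite: BremnerJozsaShepherdPRSA2011, Def. 3] -/
def PostIQP : Set (Language Bool) :=
  {L | ∃ ε : ℝ, 0 < ε ∧ ε < 1 / 2 ∧ L ∈ PostIQPWith ε}

/-- Unfolding lemma for `PostIQPWith`. (BJS 2011, Def. 3.) [cite: BremnerJozsaShepherdPRSA2011, Def. 3] -/
theorem mem_PostIQPWith_iff {ε : ℝ} {L : Language Bool} :
    L ∈ PostIQPWith ε ↔ ∃ F : PostIQPFamily, F.IsUniform ∧ F.PostDecides L ε :=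
  Iff.rfl

/-- `PostIQPWith ε ⊆ PostIQP` for `0 < ε < 1/2`. (BJS 2011, Def. 3.) [cite: BremnerJozsaShepherdPRSA2011, Def. 3] -/
theorem PostIQPWith_subset_PostIQP {ε : ℝ} (h0 : 0 < ε) (h1 : ε < 1 / 2) :
    PostIQPWith ε ⊆ PostIQP :=
  fun _ hL => ⟨ε, h0, h1, hL⟩

/-! ### The uniform multiplicative-simulation hypothesis -/

/-- **BJS's simulation hypothesis** in the tree's model: there is a constant `1 ≤ c < √2` such
that the output distribution of every polynomial-time uniform IQP family is weakly simulable to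
multiplicative error `c` (`P(y)/c ≤ Pr[A(x) = y] ≤ c·P(y)`, BJS eq. (2)) by a *uniform*
probabilistic polynomial-time sampler — `IsPPT A id` together with an exactly polynomial coin
budget `A.coinLen = q` (Gill's uniform PPT machine, as in `mem_BPP_iff_gill`; without this
conjunct `coinLen |x|` is `O(log)` advice, see the module docstring).
(BJS 2011, §2.5 (c) eq. (2), Def. 1; hypothesis of Thm. 2 and Cor. 1.) [cite: BremnerJozsaShepherdPRSA2011, §2.5 (c) and Thm. 2] -/
@[conjecture] def UniformIQPMultiplicativeSimulation : Prop :=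
  ∃ c : ℝ, 1 ≤ c ∧ c < Real.sqrt 2 ∧
    ∀ F : IQPFamily, F.IsUniform →
      ∃ A : RandAlg (List Bool) (List Bool),
        IsPPT A id ∧ (∃ q : Polynomial ℕ, ∀ n, A.coinLen n = q.eval n) ∧
          A.SamplesMultiplicative F.kernel c

/-! ### The corrected statements (BJS Thm. 2 and Cor. 1) -/

/-- **BJS Theorem 2** (Bremner–Jozsa–Shepherd 2011, Thm. 2), tree model. If there is `1 ≤ c < √2`
such that the output distributions of all uniform IQP families can be weakly classically
simulated, uniformly in probabilistic polynomial time, to within multiplicative error `c`, then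
`PostBPP = PP`. Named fact; `PostBPP_eq_PP_of_uniform_iqp_multiplicative_of_facts` reduces it to
BJS Thm. 1, the simulation argument and `PostBPP ⊆ PP`, as in the printed proof. [cite: BremnerJozsaShepherdPRSA2011, Thm. 2] -/
def PostBPP_eq_PP_of_uniform_iqp_multiplicative : Prop :=
  UniformIQPMultiplicativeSimulation → PostBPP = PP

/-- **BJS Corollary 1, corrected form of quantum-advantage.S22** (Bremner–Jozsa–Shepherd 2011,
Cor. 1). If there is `1 ≤ c < √2` such that the output distributions of all polynomial-time
uniform IQP families can be weakly simulated to within multiplicative error `c` by *uniform*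
probabilistic polynomial-time samplers, then the polynomial hierarchy collapses to its third
level, `PH = Δ₃ᵖ`.

Discrepancy with `PH_eq_DeltaP_three_of_iqp_multiplicative` (S22, same cite): (1) S22 omits the
exact-polynomial coin budget, so its samplers may depend on the advice `coinLen |x|` and the
statement is stronger than the source (BJS's proof gives only `PP ⊆ PostBPP/log` for such
samplers); (2) S22 lets `c` depend on the family (`∀ F, ∃ A c`), whereas BJS's proof of Thm. 2
fixes `c` first and then chooses the error level of the post-IQP family (`c² < 1 + 2δ`), i.e. it
proves the `∃ c, ∀ F` form stated here. `PH_eq_DeltaP_three_of_uniform_iqp_multiplicative_of_facts`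
derives this statement from Thm. 2, Toda's theorem, HHT 1997 Thm. 3.11(1), `P^{P^{Σ₂}} = P^{Σ₂}`
and `Δ₃ ⊆ Σ₃`, exactly as in the printed proof of Cor. 1. [cite: BremnerJozsaShepherdPRSA2011, Cor. 1] -/
def PH_eq_DeltaP_three_of_uniform_iqp_multiplicative : Prop :=
  UniformIQPMultiplicativeSimulation → PH = DeltaP 3

/-! ### Ingredients of the printed proofs, as named facts -/

/-- **BJS Theorem 1** (the inclusion used downstream). For every error tolerance `0 < ε < 1/2`,
`PP ⊆ PostIQPWith ε`: every `PP` language is decided with error `ε` by a uniform post-selected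
IQP family. Printed proof: `PP = PostBQP` (Aaronson 2005, Thm. 2; tree fact `PostBQP_eq_PP`),
post-BQP does not depend on the tolerance (BJS §2.4), and every uniform post-selected circuit
family over `{H, Z, CZ, e^{iπ/8 Z}}` (equivalently Clifford+T; `e^{iπ/8 Z} = e^{iπ/8} T†`) is
converted into a post-selected IQP family with the *same* conditional output probabilities by
making every line begin and end with `H` (`H² = I`) and replacing each intermediate `H` by the
Hadamard gadget `H_a CZ_{ae} H_e` on a fresh line `e` post-selected on outcome `0` of line `a`
(BJS Fig. 1). In the tree's model the gadget of the first `H` on input line `i` post-selects the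
physical input wire `i`, which is the register normal form of `PostIQPFamily`. BJS state
`post-IQP = post-BQP = PP`; only this inclusion is consumed by Thm. 2 / Cor. 1. [cite: BremnerJozsaShepherdPRSA2011, Thm. 1] -/
def PP_subset_PostIQPWith : Prop :=
  ∀ ε : ℝ, 0 < ε → ε < 1 / 2 → PP ⊆ PostIQPWith ε

/-- **The simulation argument of BJS Theorem 2** (proof of Thm. 2, eqs. (5)–(8)). Let the uniform
post-selected IQP family `F` decide `L` with tolerance `ε` (`S_w(1) ≥ 1/2 + δ`, `δ = 1/2 - ε`),
and let the uniform PPT sampler `A` simulate the full output distribution `F.kernel` to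
multiplicative error `c ≥ 1` with `c² < 1 + 2δ = 2 - 2ε`. Then `L ∈ PostBPP`: the marginals of
`A`'s output on the registers obey the same multiplicative bounds, so the post-selected classical
computation (post-select `A`'s register bits on `0…0`, output `A`'s output bit) has conditional
acceptance probability `S̃_w` with `S_w/c² ≤ S̃_w ≤ c² S_w` (eq. (8)), which is bounded away from
`1/2` on the correct side iff `c² < 1 + 2δ`; post-BPP does not depend on the error bound (BJS
§2.4; Han–Hemaspaandra–Thierauf 1997, Thm. 3.1), giving the tree's thresholds `2/3, 1/3`. The
predicates "register of `A.run x r` reads `0…0`" and "output bit of `A.run x r` is `1`" are in `P`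
because `A` is polynomial-time with an exactly polynomial (hence computable) coin budget and the
register positions `n`, `n+1…n+postLen n` are polynomial-time computable (`F.IsUniform`). [cite: BremnerJozsaShepherdPRSA2011, Thm. 2 (proof, eqs. (5)–(8))] -/
def mem_PostBPP_of_samplesMultiplicative : Prop :=
  ∀ (L : Language Bool) (ε c : ℝ) (F : PostIQPFamily) (A : RandAlg (List Bool) (List Bool)),
    0 < ε → ε < 1 / 2 → 1 ≤ c → c ^ 2 < 2 - 2 * ε →
    F.IsUniform → F.PostDecides L ε →
    IsPPT A id → (∃ q : Polynomial ℕ, ∀ n, A.coinLen n = q.eval n) →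
    A.SamplesMultiplicative F.kernel c →
    L ∈ PostBPP

/-- **Toda's theorem**: `PH ⊆ P^PP` (Toda 1991, main theorem; Arora–Barak 2009, Thm. 17.14 in
the form `PH ⊆ P^{#SAT}`, where `P^{PP} = P^{#P}` by binary search as in the proof of their
Lemma 17.7; quoted in this form by BJS 2011, §3.1). [cite: Toda1991, Main Theorem] -/
def toda_PH_subset_PRelClass_PP : Prop :=
  PH ⊆ PRelClass PP

/-- **`PostBPP ⊆ Δ₃ᵖ`** (Han–Hemaspaandra–Thierauf 1997, Thm. 3.11 (1): `BPP_path ⊆ P^{Σ₂ᵖ[log]}`,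
a fortiori `⊆ P^{Σ₂ᵖ} = Δ₃ᵖ`; `BPP_path` equals the post-selection class `PostBPP`, BJS 2011 §2.4
and Aaronson 2005 §2; quoted by BJS 2011, §3.1, eq. (1)). Printed proof: after error reduction,
Sipser's hashing predicate `Hash_X(k)` is a `Σ₂ᵖ` predicate estimating `log |X|` to within an
additive `3` for the sets of accepting resp. rejecting paths, and `x ∈ L ↔ k_R < k_A` for all but
finitely many `x`. [cite: HanHemaspaandraThierauf1997, Thm. 3.11 (1)] -/
def PostBPP_subset_DeltaP_three : Prop :=
  PostBPP ⊆ DeltaP 3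

/-- **`Δₖ₊₁ᵖ ⊆ Σₖ₊₁ᵖ ∩ Πₖ₊₁ᵖ`** (Stockmeyer 1976, §3, inclusion diagram: "since obviously
`B ∈ P(B)` and `P(B) ⊆ NP(B) ∩ co-NP(B)` for any set `B`", `Δₖ₊₁ = P(Σₖ) ⊆ Σₖ₊₁ ∩ Πₖ₊₁` with
`Σₖ₊₁ = NP(Σₖ)`; in the tree `SigmaP (k+1)` is the quantifier form `∃ᵖ·Πₖ`, identified with
`NP(Σₖ)` by Stockmeyer's Thm. 3.1 (Arora–Barak 2009, Thm. 5.12)). [cite: Stockmeyer1976, §3 (inclusion structure) with Thm. 3.1] -/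
def DeltaP_succ_subset_SigmaP_inter_PiP : Prop :=
  ∀ k : ℕ, DeltaP (k + 1) ⊆ SigmaP (k + 1) ∩ PiP (k + 1)

/-! ### Assembly (proved) -/

/-- `P^{P^C} ⊆ P^C` for a class `C`: a `P^A`-oracle with `A ∈ P^B`, `B ∈ C`, is replaced by its
polynomial-time computation with `B`-queries — from the tree's named fact
`mem_PRel_of_polyTimeTuringReducible` (`P^{P^O} = P^O`). (BJS 2011, §3.1: "for any complexity
class C we have `P^{(P^C)} = P^C`"; Ladner–Lynch–Selman 1975, §2.) [cite: BremnerJozsaShepherdPRSA2011, §3.1] -/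
theorem PRelClass_PRelClass_subset (hcomp : mem_PRel_of_polyTimeTuringReducible)
    (C : Set (Language Bool)) : PRelClass (PRelClass C) ⊆ PRelClass C := by
  intro L hL
  obtain ⟨A, hA, hLA⟩ := mem_PRelClass_iff.1 hL
  obtain ⟨B, hB, hAB⟩ := mem_PRelClass_iff.1 hA
  exact mem_PRelClass_iff.2 ⟨B, hB, hcomp hLA hAB⟩

/-- `Δ₃ᵖ = P^{Σ₂ᵖ}` (definitional in the tree: `deltaP C (k+1) = PRelClass (sigmaP C k)`).
(Stockmeyer 1976, §3.) [cite: Stockmeyer1976, §3] -/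
theorem DeltaP_three_eq : DeltaP 3 = PRelClass (SigmaP 2) :=
  rfl

/-- The error level used in the proof of BJS Thm. 2: for `1 ≤ c < √2`, `ε := (2 - c²)/4` satisfies
`0 < ε < 1/2` and `c² < 2 - 2ε` (i.e. `c² < 1 + 2δ` with `δ = 1/2 - ε`).
(BJS 2011, proof of Thm. 2: "any value of `c < √2` will suffice".) [cite: BremnerJozsaShepherdPRSA2011, Thm. 2 (proof)] -/
theorem exists_tolerance_of_lt_sqrt_two {c : ℝ} (hc1 : 1 ≤ c) (hc2 : c < Real.sqrt 2) :
    ∃ ε : ℝ, 0 < ε ∧ ε < 1 / 2 ∧ c ^ 2 < 2 - 2 * ε := by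
  have h0 : 0 ≤ c := le_trans zero_le_one hc1
  have hsq : c ^ 2 < 2 := by
    calc c ^ 2 < Real.sqrt 2 ^ 2 := by gcongr
      _ = 2 := Real.sq_sqrt (by norm_num)
  refine ⟨(2 - c ^ 2) / 4, by linarith, ?_, by linarith⟩
  have h1 : 1 ≤ c ^ 2 := by nlinarith
  linarith

/-- **BJS Theorem 2 from its printed ingredients.** Under the uniform simulation hypothesis with
constant `c < √2`: pick `ε` with `c² < 2 - 2ε` (`exists_tolerance_of_lt_sqrt_two`); every
`L ∈ PP` has a uniform post-IQP family at tolerance `ε` (Thm. 1, `PP_subset_PostIQPWith`); its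
underlying IQP family is uniform, so the hypothesis supplies a uniform multiplicative simulator,
and the simulation argument (`mem_PostBPP_of_samplesMultiplicative`) puts `L ∈ PostBPP`; with
`PostBPP ⊆ PP` (tree fact `PostBPP_subset_PP`, HHT 1997) this is `PostBPP = PP`.
(BJS 2011, proof of Thm. 2.) [cite: BremnerJozsaShepherdPRSA2011, Thm. 2 (proof)] -/
theorem PostBPP_eq_PP_of_uniform_iqp_multiplicative_of_facts
    (hThm1 : PP_subset_PostIQPWith) (hSim : mem_PostBPP_of_samplesMultiplicative)
    (hPostBPP : PostBPP_subset_PP) : PostBPP_eq_PP_of_uniform_iqp_multiplicative := by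
  rintro ⟨c, hc1, hc2, hsim⟩
  refine Set.Subset.antisymm hPostBPP fun L hL => ?_
  obtain ⟨ε, hε0, hε1, hcε⟩ := exists_tolerance_of_lt_sqrt_two hc1 hc2
  obtain ⟨F, hFu, hFd⟩ := hThm1 ε hε0 hε1 hL
  obtain ⟨A, hA, hq, hAs⟩ := hsim F.toIQPFamily hFu.1
  exact hSim L ε c F A hε0 hε1 hc1 hcε hFu hFd hA hq hAs

/-- **BJS Corollary 1 from its printed ingredients** (the corrected S22). Under the simulation
hypothesis, Thm. 2 gives `PostBPP = PP`; then
`PH ⊆ P^PP = P^PostBPP ⊆ P^{Δ₃} = P^{P^{Σ₂}} ⊆ P^{Σ₂} = Δ₃` (Toda; monotonicity of `P^{(·)}`;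
HHT 1997; `P^{P^C} = P^C`), and conversely `Δ₃ ⊆ Σ₃ ⊆ PH` (Stockmeyer), so `PH = Δ₃ᵖ`.
(BJS 2011, proof of Cor. 1 with §3.1 eq. (1).) [cite: BremnerJozsaShepherdPRSA2011, Cor. 1 (proof)] -/
theorem PH_eq_DeltaP_three_of_uniform_iqp_multiplicative_of_facts
    (hToda : toda_PH_subset_PRelClass_PP) (hThm2 : PostBPP_eq_PP_of_uniform_iqp_multiplicative)
    (hHHT : PostBPP_subset_DeltaP_three) (hΔ : DeltaP_succ_subset_SigmaP_inter_PiP)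
    (hcomp : mem_PRel_of_polyTimeTuringReducible) :
    PH_eq_DeltaP_three_of_uniform_iqp_multiplicative := by
  intro hsim
  have hPP : PostBPP = PP := hThm2 hsim
  refine Set.Subset.antisymm ?_ ?_
  · calc PH ⊆ PRelClass PP := hToda
      _ = PRelClass PostBPP := by rw [hPP]
      _ ⊆ PRelClass (DeltaP 3) := PRelClass_mono hHHT
      _ = PRelClass (PRelClass (SigmaP 2)) := by rw [DeltaP_three_eq]
      _ ⊆ PRelClass (SigmaP 2) := PRelClass_PRelClass_subset hcomp _
      _ = DeltaP 3 := DeltaP_three_eq.symm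
  · calc DeltaP 3 ⊆ SigmaP 3 := fun L hL => (hΔ 2 hL).1
      _ ⊆ PH := SigmaP_subset_PH 3

/-- **The corrected S22 from atomic named facts**: BJS Thm. 1, the simulation argument,
`PostBPP ⊆ PP`, Toda, HHT 1997 Thm. 3.11(1), Stockmeyer's `Δₖ₊₁ ⊆ Σₖ₊₁ ∩ Πₖ₊₁` and
`P^{P^O} = P^O`. (BJS 2011, Thm. 2 and Cor. 1.) [cite: BremnerJozsaShepherdPRSA2011, Cor. 1 (proof)] -/
theorem PH_eq_DeltaP_three_of_uniform_iqp_multiplicative_of_atomic_facts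
    (hThm1 : PP_subset_PostIQPWith) (hSim : mem_PostBPP_of_samplesMultiplicative)
    (hPostBPP : PostBPP_subset_PP) (hToda : toda_PH_subset_PRelClass_PP)
    (hHHT : PostBPP_subset_DeltaP_three) (hΔ : DeltaP_succ_subset_SigmaP_inter_PiP)
    (hcomp : mem_PRel_of_polyTimeTuringReducible) :
    PH_eq_DeltaP_three_of_uniform_iqp_multiplicative :=
  PH_eq_DeltaP_three_of_uniform_iqp_multiplicative_of_facts hToda
    (PostBPP_eq_PP_of_uniform_iqp_multiplicative_of_facts hThm1 hSim hPostBPP) hHHT hΔ hcomp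

/-- Every witness of the corrected hypothesis (`∃ c, ∀ F`, uniform samplers) is a witness of
S22's hypothesis (`∀ F, ∃ A c`, no coin-budget condition): forget the coin budget and reuse the
one constant `c`. The converse fails in general (advice-dependent samplers, family-dependent
`c`), which is the content of the mis-statement. [folklore] -/
theorem s22Hypothesis_of_uniformIQPMultiplicativeSimulation
    (h : UniformIQPMultiplicativeSimulation) :
    ∀ F : IQPFamily, F.IsUniform → ∃ (A : RandAlg (List Bool) (List Bool)) (c : ℝ),
      1 ≤ c ∧ c < Real.sqrt 2 ∧ IsPPT A id ∧ A.SamplesMultiplicative F.kernel c := by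
  obtain ⟨c, hc1, hc2, hsim⟩ := h
  intro F hF
  obtain ⟨A, hA, -, hAs⟩ := hsim F hF
  exact ⟨A, c, hc1, hc2, hA, hAs⟩

/-- Consequently S22 as vendored (weaker hypothesis, same conclusion) implies the corrected
statement: a discharge of `PH_eq_DeltaP_three_of_iqp_multiplicative` would also discharge BJS
Cor. 1 in the printed form. [folklore] -/
theorem PH_eq_DeltaP_three_of_uniform_iqp_multiplicative_of_s22
    (h : PH_eq_DeltaP_three_of_iqp_multiplicative) :
    PH_eq_DeltaP_three_of_uniform_iqp_multiplicative :=
  fun hsim => h (s22Hypothesis_of_uniformIQPMultiplicativeSimulation hsim)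

end Literature.Computability.QuantumComplexity
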